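import Summits.SmoothPoincare4.SmoothPoincare4.Theorems.SblfDescentRungOneHelperTimelikeLoopReversal
import Literature.AlgebraicTopology.FundamentalGroup.PuncturedPlane
import Mathlib.Analysis.SpecialFunctions.Complex.Circle
import Mathlib.Topology.Algebra.Order.Floor
import HarnessLib

/-!
# Loops in a region dominated by the punctured plane are multiples of the core circle

Helper layer `helper_timelike_circleDominated` (generic topology) of stub `helper_foldNF_timelike`
(the untwistedness of the round `1`-handle of a genus-one simplified broken Lefschetz
fibration), line `Sketch`, crux `SblfDescent.RungOne`.

(Crux item stmt-SmoothPoincare4-18531; skeleton `Cruxes/RungOne/Lines/Sketch.lean`.)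

Near a round point the higher-genus side of the fold looks like (interval) × (the outside of a
double cone in `ℝ³`), a region which retracts onto a circle — the vanishing cycle.  This file
isolates the homological bookkeeping (`helper_timelike_circleDominated`): let `G ⊆ Y`, a map
`R : G → ℂ ∖ 0`, a radially invariant "core circle" `C : ℂ ∖ 0 → G` and a deformation `K` of
`G` inside `G` from the identity to `C ∘ R` (so `G` is dominated by the punctured plane).  Then
the Hurewicz class of every loop of `Y` running in `G` is an integer multiple of the class of
the core loop `τ ↦ C (e^{2πiτ})`: deform the loop onto `C ∘ R ∘ γ` (free homotopies preserve
`H₁`-classes, Hatcher 2002, Thm. 2.10), rotate its base point to the positive axis, and write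
the loop `R ∘ γ` of `ℂ ∖ 0` as a power of the winding loop (Hatcher 2002, Thm. 1.7, the
tree's `PuncturedPlane.exists_homotopic_windingLoop`), through the Hurewicz homomorphism
(Thm. 2A.1).

## References

* A. Hatcher, *Algebraic Topology* (2002), Thm. 1.7, Thm. 2.10, Thm. 2A.1. [HatcherAT2002]
-/

set_option linter.dupNamespace false

noncomputable section

open scoped Topology unitInterval
open Set Function Filter Complex Literature.AlgebraicTopology.SingularHomology
  Literature.AlgebraicTopology.FundamentalGroup.PuncturedPlane

namespace Summit.SmoothPoincare4.SmoothPoincare4.Cruxes.RungOne.Sketch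

/-! ### Free homotopies preserve Hurewicz classes -/

/-- **Freely homotopic loops have the same Hurewicz class.**  If `F : ℝ × ℝ → Y` is continuous
and `1`-periodic in the second variable, the loops `F (0, ·)|[0,1]` and `F (1, ·)|[0,1]` have
the same class in `H₁(Y; ℤ)` (descend to maps of the circle `ℝ/ℤ`, homotopy invariance of
`H₁`, naturality of the Hurewicz class of the standard loop). [cite: HatcherAT2002, Thm. 2.10 and Thm. 2A.1] -/
theorem loopClass_eq_of_freeHomotopy {Y : Type} [TopologicalSpace Y] {F : ℝ × ℝ → Y}
    (hF : Continuous F) (hp : ∀ s θ : ℝ, F (s, θ + 1) = F (s, θ)) {x₀ x₁ : Y}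
    (γ₀ : Path x₀ x₀) (γ₁ : Path x₁ x₁) (h₀ : ∀ τ : unitInterval, γ₀ τ = F (0, (τ : ℝ)))
    (h₁ : ∀ τ : unitInterval, γ₁ τ = F (1, (τ : ℝ))) :
    loopClass ℤ ℤ (1 : ℤ) γ₀ = loopClass ℤ ℤ (1 : ℤ) γ₁ := by
  obtain ⟨Fd, hFd, hFdap⟩ := exists_descend_periodic hF hp
  set ℓ₀ : C(AddCircle (1 : ℝ), Y) :=
    ⟨fun θ => Fd (0, θ), hFd.comp (continuous_const.prodMk continuous_id)⟩ with hℓ₀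
  set ℓ₁ : C(AddCircle (1 : ℝ), Y) :=
    ⟨fun θ => Fd (1, θ), hFd.comp (continuous_const.prodMk continuous_id)⟩ with hℓ₁
  have h01 : ℓ₀.Homotopic ℓ₁ :=
    ⟨{ toFun := fun q => Fd ((q.1 : ℝ), q.2)
       continuous_toFun := hFd.comp (continuous_subtype_val.prodMap continuous_id)
       map_zero_left := fun θ => rfl
       map_one_left := fun θ => rfl }⟩
  obtain ⟨sl, hsl⟩ : ∃ sl : Path (0 : AddCircle (1 : ℝ)) (0 : AddCircle (1 : ℝ)),
      ∀ τ : unitInterval, sl τ = ((τ : ℝ) : AddCircle (1 : ℝ)) :=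
    ⟨{ toFun := fun τ => ((τ : ℝ) : AddCircle (1 : ℝ))
       continuous_toFun := QuotientAddGroup.continuous_mk.comp continuous_subtype_val
       source' := by simp
       target' := by simp }, fun τ => rfl⟩
  have e₀ : x₀ = ℓ₀ 0 := by
    have := h₀ 0
    rw [γ₀.source] at this
    rw [this]; change F (0, 0) = Fd (0, ((0 : ℝ) : AddCircle (1 : ℝ))); rw [hFdap]
  have e₁ : x₁ = ℓ₁ 0 := by
    have := h₁ 0
    rw [γ₁.source] at this
    rw [this]; change F (1, 0) = Fd (1, ((0 : ℝ) : AddCircle (1 : ℝ))); rw [hFdap]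
  have hγ₀ : γ₀ = (sl.map ℓ₀.continuous).cast e₀ e₀ := by
    ext τ; rw [h₀ τ]; change F (0, (τ : ℝ)) = Fd (0, sl τ); rw [hsl, hFdap]
  have hγ₁ : γ₁ = (sl.map ℓ₁.continuous).cast e₁ e₁ := by
    ext τ; rw [h₁ τ]; change F (1, (τ : ℝ)) = Fd (1, sl τ); rw [hsl, hFdap]
  rw [hγ₀, hγ₁, loopClass_cast, loopClass_cast, ← map_loopClass, ← map_loopClass,
    singularHomology.map_eq_of_homotopic ℤ ℤ h01]

/-! ### Loops of the punctured plane -/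

/-- **Every loop class of `ℂ ∖ 0` at a positive real base point is a multiple of the class of
the winding loop.** [cite: HatcherAT2002, Thm. 1.7 and Thm. 2A.1] -/
theorem exists_loopClass_eq_zsmul_windingLoop (r : ℝ) (hr : 0 < r) (δ : Path (bpt r hr) (bpt r hr)) :
    ∃ k : ℤ, loopClass ℤ ℤ (1 : ℤ) δ = k • loopClass ℤ ℤ (1 : ℤ) (windingLoop r hr 1) := by
  obtain ⟨m, hm⟩ := exists_homotopic_windingLoop r hr δ
  obtain ⟨k, hk⟩ := Subgroup.mem_zpowers_iff.1 (windingLoop_mem_zpowers r hr m)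
  refine ⟨k, ?_⟩
  rw [loopClass_eq_of_homotopic ℤ ℤ (1 : ℤ) hm]
  have h := congrArg (fun g => Multiplicative.toAdd (hurewiczOne ℤ ℤ (1 : ℤ) (bpt r hr) g)) hk
  simpa only [map_zpow, hurewiczOne_fromPath, toAdd_zpow, toAdd_ofAdd] using h.symm

/-! ### The domination lemma -/

/-- **Loops in a region dominated by the punctured plane.**  Let `G ⊆ Y`, `R : Y → ℂ`
continuous and non-vanishing on `G`, `C : ℂ → Y` continuous off `0`, radially invariant
(`C z = C (z/‖z‖)`), with values in `G`, and `K : ℝ × Y → Y` continuous on `ℝ × G`, preserving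
`G`, with `K (0, ·) = id` and `K (1, ·) = C ∘ R` on `G`.  Then for every loop `γ` of `Y`
running in `G` there is `m ∈ ℤ` with `h(γ) = m · h(β)` in `H₁(Y; ℤ)`, `β (τ) = C (e^{2πiτ})`
the core loop. [cite: HatcherAT2002, Thm. 1.7, Thm. 2.10 and Thm. 2A.1] -/
theorem helper_timelike_circleDominated : ∀ (Y : Type) [TopologicalSpace Y] (G : Set Y) (R : Y → ℂ) (C : ℂ → Y) (K : ℝ × Y → Y), ContinuousOn R G → (∀ p ∈ G, R p ≠ 0) → ContinuousOn C {z : ℂ | z ≠ 0} → (∀ z : ℂ, z ≠ 0 → C z ∈ G) → (∀ z : ℂ, z ≠ 0 → C z = C ((‖z‖⁻¹ : ℂ) * z)) → ContinuousOn K (Set.univ ×ˢ G) → (∀ (s : ℝ) (p : Y), p ∈ G → K (s, p) ∈ G) → (∀ p ∈ G, K (0, p) = p) → (∀ p ∈ G, K (1, p) = C (R p)) → ∀ (x₀ : Y) (γ : Path x₀ x₀), (∀ τ : unitInterval, γ τ ∈ G) → ∀ (β : Path (C 1) (C 1)), (∀ τ : unitInterval, β τ = C (Complex.exp (2 * Real.pi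 * (τ : ℝ) * Complex.I))) → ∃ m : ℤ, loopClass ℤ ℤ (1 : ℤ) γ = m • loopClass ℤ ℤ (1 : ℤ) β := by
  intro Y _ G R C K hR hR0 hC hCG hCrad hK hKG hK0 hK1 x₀ γ hγG β hβ
  have hx₀ : x₀ ∈ G := by simpa using hγG 0
  -- Step 1: the periodic extension `γ̃` of `γ` and the free homotopy `K (s, γ̃ θ)`
  set γt : ℝ → Y := fun θ => γ.extend (Int.fract θ) with hγt
  have hγtc : Continuous γt := by
    have h : ContinuousOn (fun t : ℝ => γ.extend t) (Icc 0 1) := γ.continuous_extend.continuousOn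
    exact ContinuousOn.comp_fract'' h (by simp [γ.extend_zero, γ.extend_one])
  have hγtG : ∀ θ, γt θ ∈ G := fun θ => by
    simp only [hγt]
    rw [γ.extend_apply ⟨Int.fract_nonneg θ, (Int.fract_lt_one θ).le⟩]
    exact hγG _
  have hγtτ : ∀ τ : unitInterval, γ τ = γt τ := fun τ => by
    simp only [hγt]
    rcases eq_or_lt_of_le τ.2.2 with h1 | h1
    · have : (τ : ℝ) = 1 := h1
      rw [this, Int.fract_one, γ.extend_zero, show τ = 1 from Subtype.ext this, γ.target]
    · rw [Int.fract_eq_self.2 ⟨τ.2.1, h1⟩, γ.extend_apply τ.2]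
  have hγt0 : γt 0 = x₀ := by simp [hγt]
  set F : ℝ × ℝ → Y := fun q => K (q.1, γt q.2) with hFdef
  have hFc : Continuous F :=
    hK.comp_continuous (continuous_fst.prodMk (hγtc.comp continuous_snd))
      fun q => ⟨mem_univ _, hγtG q.2⟩
  have hFp : ∀ s θ : ℝ, F (s, θ + 1) = F (s, θ) := fun s θ => by
    simp only [hFdef, hγt, Int.fract_add_one]
  -- the deformed loop `γ₁ = C ∘ R ∘ γ̃`
  set x₁ : Y := C (R x₀) with hx₁
  obtain ⟨γ₁, hγ₁⟩ : ∃ γ₁ : Path x₁ x₁, ∀ τ : unitInterval, γ₁ τ = C (R (γt τ)) :=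
    ⟨{ toFun := fun τ => C (R (γt τ))
       continuous_toFun := by
         have hRc : Continuous fun θ => R (γt θ) := hR.comp_continuous hγtc hγtG
         have hCc : Continuous fun θ => C (R (γt θ)) :=
           hC.comp_continuous hRc fun θ => hR0 _ (hγtG θ)
         exact hCc.comp continuous_subtype_val
       source' := by simp [hγt0, hx₁]
       target' := by
         simp only [Set.Icc.coe_one]
         rw [show γt 1 = x₀ by simp [hγt], hx₁] }, fun τ => rfl⟩
  have hcls₁ : loopClass ℤ ℤ (1 : ℤ) γ = loopClass ℤ ℤ (1 : ℤ) γ₁ :=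
    loopClass_eq_of_freeHomotopy hFc hFp γ γ₁
      (fun τ => by rw [hγtτ τ]; exact (hK0 _ (hγtG _)).symm)
      (fun τ => by rw [hγ₁ τ]; exact (hK1 _ (hγtG _)).symm)
  -- Step 2: `γ₁ = Ĉ ∘ δ` for the loop `δ = R ∘ γ̃` of `ℂ ∖ 0`
  set Ch : C(CStar, Y) := ⟨fun z => C z.1, hC.comp_continuous continuous_subtype_val fun z => z.2⟩
    with hCh
  set z₀ : CStar := ⟨R x₀, hR0 x₀ hx₀⟩ with hz₀
  obtain ⟨δ, hδ⟩ : ∃ δ : Path z₀ z₀, ∀ τ : unitInterval, (δ τ : ℂ) = R (γt τ) :=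
    ⟨{ toFun := fun τ => ⟨R (γt τ), hR0 _ (hγtG τ)⟩
       continuous_toFun := ((hR.comp_continuous hγtc hγtG).comp continuous_subtype_val).subtype_mk _
       source' := Subtype.ext (by simp [hγt0, hz₀])
       target' := Subtype.ext (by
         simp only [Set.Icc.coe_one]
         rw [show γt 1 = x₀ by simp [hγt]]) }, fun τ => rfl⟩
  have hγ₁δ : γ₁ = δ.map Ch.continuous := by
    ext τ
    rw [hγ₁ τ]
    change C (R (γt τ)) = C ((δ τ : CStar) : ℂ)
    rw [hδ]
  -- Step 3: rotate the base point of `δ` to the positive real axis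
  set r₀ : ℝ := ‖R x₀‖ with hr₀def
  have hr₀ : 0 < r₀ := norm_pos_iff.2 (hR0 x₀ hx₀)
  set c : ℂ := (r₀ : ℂ) / R x₀ with hcdef
  have hc0 : c ≠ 0 := div_ne_zero (ofReal_ne_zero.2 hr₀.ne') (hR0 x₀ hx₀)
  have hcz₀ : c * R x₀ = r₀ := by rw [hcdef, div_mul_cancel₀ _ (hR0 x₀ hx₀)]
  -- multiplication by `c`, `c⁻¹`, as self-maps of `ℂ ∖ 0`
  set Mc : C(CStar, CStar) := ⟨fun z => ⟨c * z.1, mul_ne_zero hc0 z.2⟩,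
    (continuous_const.mul continuous_subtype_val).subtype_mk _⟩ with hMc
  set Mci : C(CStar, CStar) := ⟨fun z => ⟨c⁻¹ * z.1, mul_ne_zero (inv_ne_zero hc0) z.2⟩,
    (continuous_const.mul continuous_subtype_val).subtype_mk _⟩ with hMci
  have hbase : Mc z₀ = bpt r₀ hr₀ := Subtype.ext (by simp [hMc, hz₀, hcz₀])
  set δ' : Path (bpt r₀ hr₀) (bpt r₀ hr₀) := (δ.map Mc.continuous).cast hbase.symm hbase.symm
    with hδ'
  -- `Ĉ ∘ Mci ≃ Ĉ` (rotate back along the unit circle; `C` is radially invariant)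
  have hChMci : (Ch.comp Mci).Homotopic Ch := by
    -- the unit complex number `u = (c⁻¹/‖c⁻¹‖)` and the arc from `u` to `1`
    set u : ℂ := (‖c⁻¹‖⁻¹ : ℂ) * c⁻¹ with hu
    have hu1 : ‖u‖ = 1 := by
      rw [hu, norm_mul, norm_inv, Complex.norm_real, Real.norm_eq_abs, abs_of_pos (norm_pos_iff.2 (inv_ne_zero hc0)),
        inv_mul_cancel₀ (norm_ne_zero_iff.2 (inv_ne_zero hc0))]
    set arc : ℝ → ℂ := fun s => Complex.exp ((((1 - s) * Complex.arg u : ℝ) : ℂ) * Complex.I) with harc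
    have harc_c : Continuous arc := by simp only [harc]; fun_prop
    have harc0 : arc 0 = u := by
      have h := Complex.norm_mul_exp_arg_mul_I u
      rw [hu1, Complex.ofReal_one, one_mul] at h
      simp only [harc, sub_zero, one_mul]
      exact h
    have harc1 : arc 1 = 1 := by simp [harc]
    have harc_ne : ∀ s, arc s ≠ 0 := fun s => Complex.exp_ne_zero _
    have hrad : ∀ z : CStar, C (c⁻¹ * z.1) = C (u * z.1) := fun z => by
      rw [hCrad _ (mul_ne_zero (inv_ne_zero hc0) z.2), hCrad _ (mul_ne_zero (by
        rw [← norm_ne_zero_iff, hu1]; exact one_ne_zero) z.2)]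
      congr 1
      rw [norm_mul, norm_mul, hu1, one_mul, hu]
      push_cast
      field_simp
    refine ⟨{ toFun := fun q => C (arc q.1 * q.2.1)
              continuous_toFun := ?_
              map_zero_left := fun z => ?_
              map_one_left := fun z => ?_ }⟩
    · have h1 : Continuous fun q : unitInterval × CStar => arc q.1 * q.2.1 :=
        (harc_c.comp continuous_subtype_val |>.comp continuous_fst).mul
          (continuous_subtype_val.comp continuous_snd)
      exact hC.comp_continuous h1 fun q => mul_ne_zero (harc_ne _) q.2.2
    · change C (arc 0 * z.1) = C (c⁻¹ * z.1)
      rw [harc0, hrad]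
    · change C (arc 1 * z.1) = C z.1
      rw [harc1, one_mul]
  have hcls₂ : loopClass ℤ ℤ (1 : ℤ) γ₁ = singularHomology.map ℤ ℤ Ch 1 (loopClass ℤ ℤ (1 : ℤ) δ') := by
    have hfac : Ch = (Ch.comp Mci).comp Mc := by
      ext z
      change C z.1 = C (c⁻¹ * (c * z.1))
      rw [← mul_assoc, inv_mul_cancel₀ hc0, one_mul]
    rw [hγ₁δ, ← map_loopClass, hδ', loopClass_cast, ← map_loopClass]
    conv_lhs => rw [hfac]
    rw [singularHomology.map_comp, CategoryTheory.comp_apply,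
      singularHomology.map_eq_of_homotopic ℤ ℤ hChMci]
  -- Step 4: `δ'` is a power of the winding loop, and `Ĉ ∘ w₁` is the core loop `β`
  obtain ⟨k, hk⟩ := exists_loopClass_eq_zsmul_windingLoop r₀ hr₀ δ'
  have hcore : singularHomology.map ℤ ℤ Ch 1 (loopClass ℤ ℤ (1 : ℤ) (windingLoop r₀ hr₀ 1)) =
      loopClass ℤ ℤ (1 : ℤ) β := by
    rw [map_loopClass]
    refine loopClass_eq_of_ofPath_eq ℤ ℤ (1 : ℤ) _ _ ?_
    have hfun : ⇑((windingLoop r₀ hr₀ 1).map Ch.continuous) = ⇑β := by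
      funext τ
      rw [hβ τ]
      change C ((windingLoop r₀ hr₀ 1 τ : CStar) : ℂ) = _
      rw [windingLoop_apply_coe, hCrad _ (mul_ne_zero (ofReal_ne_zero.2 hr₀.ne') (Complex.exp_ne_zero _))]
      congr 1
      have hn : ‖(r₀ : ℂ) * Complex.exp (((2 * Real.pi * (1 : ℤ) * (τ : ℝ) : ℝ) : ℂ) * Complex.I)‖ = r₀ := by
        rw [norm_mul, Complex.norm_real, Real.norm_eq_abs, abs_of_pos hr₀, Complex.norm_exp_ofReal_mul_I,
          mul_one]
      rw [hn, ← mul_assoc, ← ofReal_inv, ← ofReal_mul, inv_mul_cancel₀ hr₀.ne', ofReal_one, one_mul]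
      push_cast
      ring_nf
    unfold SingularSimplex.ofPath
    congr 1
    exact ContinuousMap.ext fun t => by
      change ((windingLoop r₀ hr₀ 1).map Ch.continuous) (StdSimplex.toUnitInterval t) =
        β (StdSimplex.toUnitInterval t)
      rw [hfun]
  refine ⟨k, ?_⟩
  rw [hcls₁, hcls₂, hk, map_zsmul, hcore]

end Summit.SmoothPoincare4.SmoothPoincare4.Cruxes.RungOne.Sketch

end
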